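import Literature.Topology.FourManifolds.NonSeparatingSpheresSurgeryModel
import Mathlib.LinearAlgebra.Matrix.NonsingularInverse
import Mathlib.Analysis.Calculus.FDeriv.Pi
import HarnessLib

/-!
# A unit normal field along an immersed disc in a sphere (Budney–Gabai Thm. 3.13, Cerf–Palais step, III)

Fact seat of `Literature.Topology.FourManifolds.BudneyGabai2019_thm_3_13` (`NonSeparatingSpheres.lean`;
R. Budney, D. Gabai, *Knotted 3-balls in `S⁴`*, arXiv:1912.09029 (v2), Thm. 3.13).  To apply the
Cerf–Palais disc theorem of the source's remark after Thm. 3.12 (*"there is a diffeomorphism of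
this sphere taking `Δ₁` to a standard `n`-ball"*) in the tree's top-dimensional form
(`UnorientedDiscTheorem.lean`), the `n`-ball `Δ₁ ⊆ Sⁿ⁺¹` — parametrised by the surgery disc
`φ : ℝⁿ → Sⁿ⁺¹` of `NonSeparatingSpheresSurgeryDisc.lean` — has to be thickened to an
`(n+1)`-disc along a normal vector field.  This file constructs the normal field, for any smooth
immersion `φ : ℝⁿ → Sⁿ⁺¹ ⊆ ℝⁿ⁺²`:

* `Surgery.baseMatrix`, `Surgery.detRow`, `Surgery.detRowLin`, `Surgery.crossVec` — the
  **generalised cross product** `ν̃ y = ⋆(Φ y ∧ ∂₁Φ y ∧ ⋯ ∧ ∂ₙΦ y)` (`Φ = ι ∘ φ`), defined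
  coordinatewise by the determinants `det (eⱼ, Φ y, ∂₁Φ y, …, ∂ₙΦ y)`; it represents the linear
  functional `w ↦ det (w, Φ y, ∂Φ y)` (`inner_crossVec`), hence is orthogonal to `Φ y` and to every
  `∂_ξ Φ y` (`inner_crossVec_self`, `inner_crossVec_fderiv`), depends smoothly on `y`
  (`contDiff_crossVec`: a polynomial in `Φ` and `∂Φ`), and is non-zero as soon as
  `(Φ y, ∂Φ y)` are independent (`crossVec_ne_zero`), which is the case along an immersion into
  the sphere (`linearIndependent_cons_fderiv`: the `∂ₖΦ` are independent and tangent, i.e.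
  orthogonal to the unit vector `Φ y`, `range_mfderiv_coe_sphere`);
* `crossVec_eq_smul_single` — along a map into the equatorial great sphere `{v₁ = 0}` the cross
  product is a multiple of `e₁`, of constant sign on the connected `ℝⁿ`
  (`forall_pos_or_forall_neg`);
* **`exists_unitNormal`** — for a smooth immersion `φ` agreeing on an open set `U` with an
  immersion `ψ` into `{v₁ = 0}`: a smooth unit normal field along `φ`, tangent to `Sⁿ⁺¹`, normal
  to the disc, and **equal to `e₁` on `U`** (normalise `ν̃`, fix the global sign).

Everything here is proved; the definitions are explicit formulas; no named facts are introduced.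
(Differential-topological content: the normal bundle of an immersed disc of codimension one in
`Sⁿ⁺¹` is trivialised by the Hodge star of `Φ ∧ dΦ`; cf. Hirsch, *Differential Topology*
(1976), Ch. 4 §5 on fields of transverse planes.)

## References

* R. Budney, D. Gabai, *Knotted 3-balls in `S⁴`*, arXiv:1912.09029 (v2), §3, remark after
  Thm. 3.12, proof of Thm. 3.13 (p. 22). [BudneyGabai2019]
* M. W. Hirsch, *Differential Topology*, GTM 33 (1976), Ch. 4 §5. [HirschDT1976]
-/

noncomputable section

open scoped Manifold ContDiff Topology Real RealInnerProductSpace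
open Set Function Metric Module Matrix

/-- Local notation: Euclidean model space. -/
local notation "𝔼 " n:arg => EuclideanSpace ℝ (Fin n)
/-- Local notation: the unit sphere `Sⁿ ⊆ ℝⁿ⁺¹`. -/
local notation "𝕊 " n:arg => (Metric.sphere (0 : EuclideanSpace ℝ (Fin (n + 1))) 1)

namespace Literature.Topology.FourManifolds

namespace BudneyGabai2019_thm_3_13

namespace Surgery

attribute [local instance] fact_finrank_euclideanSpace_succ

variable {n : ℕ}

/-! ### The generalised cross product of a map `ℝⁿ → ℝⁿ⁺²` -/

/-- The **base matrix** of a map `Φ : ℝⁿ → ℝⁿ⁺²` at `y`: rows `(0, Φ y, ∂₁Φ y, …, ∂ₙΦ y)` (the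
row `0` is a placeholder for the argument of the determinant functional). [folklore] -/
def baseMatrix (Φ : 𝔼 n → 𝔼 (n + 1 + 1)) (y : 𝔼 n) : Matrix (Fin (n + 1 + 1)) (Fin (n + 1 + 1)) ℝ :=
  Matrix.of (Fin.cons (0 : Fin (n + 1 + 1) → ℝ)
    (Fin.cons (⇑(Φ y)) fun k : Fin n ↦ ⇑(fderiv ℝ Φ y (EuclideanSpace.single k 1))))

/-- The **determinant functional** `r ↦ det (r, Φ y, ∂₁Φ y, …, ∂ₙΦ y)`. [folklore] -/
def detRow (Φ : 𝔼 n → 𝔼 (n + 1 + 1)) (y : 𝔼 n) (r : Fin (n + 1 + 1) → ℝ) : ℝ :=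
  det (updateRow (baseMatrix Φ y) 0 r)

/-- The **generalised cross product** `ν̃ y = ⋆(Φ y ∧ ∂₁Φ y ∧ ⋯ ∧ ∂ₙΦ y) ∈ ℝⁿ⁺²`: its `j`-th
coordinate is `det (eⱼ, Φ y, ∂₁Φ y, …, ∂ₙΦ y)`. [folklore] -/
def crossVec (Φ : 𝔼 n → 𝔼 (n + 1 + 1)) (y : 𝔼 n) : 𝔼 (n + 1 + 1) :=
  WithLp.toLp 2 fun j ↦ detRow Φ y (Pi.single j 1)

variable (Φ : 𝔼 n → 𝔼 (n + 1 + 1)) (y : 𝔼 n)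

/-- Row `0` of the base matrix. [folklore] -/
@[simp] theorem baseMatrix_zero : baseMatrix Φ y 0 = 0 := rfl

/-- Row `1` of the base matrix is `Φ y`. [folklore] -/
@[simp] theorem baseMatrix_one : baseMatrix Φ y (Fin.succ 0) = ⇑(Φ y) := rfl

/-- Row `k + 2` of the base matrix is `∂ₖΦ y`. [folklore] -/
@[simp] theorem baseMatrix_succ_succ (k : Fin n) :
    baseMatrix Φ y k.succ.succ = ⇑(fderiv ℝ Φ y (EuclideanSpace.single k 1)) := rfl

/-- The determinant functional is additive. [folklore] -/
theorem detRow_add (r s : Fin (n + 1 + 1) → ℝ) : detRow Φ y (r + s) = detRow Φ y r + detRow Φ y s :=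
  det_updateRow_add _ _ _ _

/-- The determinant functional is homogeneous. [folklore] -/
theorem detRow_smul (c : ℝ) (r : Fin (n + 1 + 1) → ℝ) : detRow Φ y (c • r) = c * detRow Φ y r :=
  det_updateRow_smul _ _ _ _

/-- The determinant functional as a linear map. [folklore] -/
def detRowLin : (Fin (n + 1 + 1) → ℝ) →ₗ[ℝ] ℝ where
  toFun := detRow Φ y
  map_add' := detRow_add Φ y
  map_smul' := detRow_smul Φ y

/-- **The cross product represents the determinant functional**:
`⟪ν̃ y, w⟫ = det (w, Φ y, ∂₁Φ y, …, ∂ₙΦ y)`. [folklore] -/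
theorem inner_crossVec (w : 𝔼 (n + 1 + 1)) : ⟪crossVec Φ y, w⟫ = detRow Φ y (⇑w) := by
  have hw : (⇑w : Fin (n + 1 + 1) → ℝ) = ∑ j, (w j) • Pi.single (M := fun _ ↦ ℝ) j 1 :=
    pi_eq_sum_univ' _
  conv_rhs => rw [hw]
  rw [show detRow Φ y (∑ j, (w j) • Pi.single (M := fun _ ↦ ℝ) j 1) =
    detRowLin Φ y (∑ j, (w j) • Pi.single (M := fun _ ↦ ℝ) j 1) from rfl, map_sum]
  simp only [map_smul, smul_eq_mul]
  rw [PiLp.inner_apply]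
  refine Finset.sum_congr rfl fun j _ ↦ ?_
  show ⟪detRow Φ y (Pi.single j 1), w j⟫ = w j * detRow Φ y (Pi.single j 1)
  rw [RCLike.inner_apply, conj_trivial]

/-- The row `Φ y` is in the kernel of the determinant functional (repeated row). [folklore] -/
theorem detRow_self : detRow Φ y (⇑(Φ y)) = 0 := by
  refine det_zero_of_row_eq (i := 0) (j := Fin.succ 0) (by simp) ?_
  rw [updateRow_self, updateRow_ne (Fin.succ_ne_zero 0), baseMatrix_one]

/-- The rows `∂ₖΦ y` are in the kernel of the determinant functional (repeated row). [folklore] -/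
theorem detRow_fderiv_single (k : Fin n) :
    detRow Φ y (⇑(fderiv ℝ Φ y (EuclideanSpace.single k 1))) = 0 := by
  refine det_zero_of_row_eq (i := 0) (j := k.succ.succ) (by simp [Fin.ext_iff]) ?_
  rw [updateRow_self, updateRow_ne (Fin.succ_ne_zero _), baseMatrix_succ_succ]

/-- `⟪ν̃ y, Φ y⟫ = 0`. [folklore] -/
theorem inner_crossVec_self : ⟪crossVec Φ y, Φ y⟫ = 0 := by
  rw [inner_crossVec, detRow_self]

/-- `⟪ν̃ y, ∂_ξ Φ y⟫ = 0` for every direction `ξ` (when `Φ` is differentiable at `y`).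
[folklore] -/
theorem inner_crossVec_fderiv (ξ : 𝔼 n) : ⟪crossVec Φ y, fderiv ℝ Φ y ξ⟫ = 0 := by
  have hξ : ξ = ∑ k, (ξ k) • EuclideanSpace.single k (1 : ℝ) := by
    simpa using ((EuclideanSpace.basisFun (Fin n) ℝ).sum_repr ξ).symm
  rw [hξ, map_sum, inner_sum]
  refine Finset.sum_eq_zero fun k _ ↦ ?_
  rw [map_smul, inner_smul_right, inner_crossVec, detRow_fderiv_single, mul_zero]


/-! ### Smoothness of the cross product -/

variable {Φ}

/-- The entries of the matrix `(r, Φ y, ∂Φ y)` depend smoothly on `y`. [folklore] -/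
theorem contDiff_updateRow_baseMatrix (hΦ : ContDiff ℝ ∞ Φ) (r : Fin (n + 1 + 1) → ℝ)
    (i j : Fin (n + 1 + 1)) : ContDiff ℝ ∞ fun y ↦ updateRow (baseMatrix Φ y) 0 r i j := by
  refine Fin.cases ?_ (fun i' ↦ Fin.cases ?_ (fun k ↦ ?_) i') i
  · simp only [updateRow_self]
    exact contDiff_const
  · simp only [updateRow_ne (Fin.succ_ne_zero _), baseMatrix_one]
    exact (contDiff_piLp_apply (𝕜 := ℝ) (p := 2) (i := j)).comp hΦ
  · simp only [updateRow_ne (Fin.succ_ne_zero _), baseMatrix_succ_succ]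
    have h1 : ContDiff ℝ ∞ (fun y ↦ fderiv ℝ Φ y (EuclideanSpace.single k 1)) :=
      (hΦ.fderiv_right (m := ∞) (by norm_cast)).clm_apply contDiff_const
    exact (contDiff_piLp_apply (𝕜 := ℝ) (p := 2) (i := j)).comp h1

/-- **The determinant functional depends smoothly on the point** (it is a polynomial in the
entries). [folklore] -/
theorem contDiff_detRow (hΦ : ContDiff ℝ ∞ Φ) (r : Fin (n + 1 + 1) → ℝ) :
    ContDiff ℝ ∞ fun y ↦ detRow Φ y r := by
  unfold detRow
  simp_rw [det_apply']
  refine ContDiff.sum fun σ _ ↦ contDiff_const.mul (contDiff_prod fun i _ ↦ ?_)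
  exact contDiff_updateRow_baseMatrix hΦ r _ _

/-- **The cross product is smooth.** [folklore] -/
theorem contDiff_crossVec (hΦ : ContDiff ℝ ∞ Φ) : ContDiff ℝ ∞ (crossVec Φ) := by
  rw [contDiff_euclidean]
  intro j
  exact contDiff_detRow hΦ _

/-- The cross product only depends on the `1`-jet of `Φ` at the point. [folklore] -/
theorem crossVec_congr {Ψ : 𝔼 n → 𝔼 (n + 1 + 1)} (h0 : Φ y = Ψ y) (h1 : fderiv ℝ Φ y = fderiv ℝ Ψ y) :
    crossVec Φ y = crossVec Ψ y := by
  have hb : baseMatrix Φ y = baseMatrix Ψ y := by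
    unfold baseMatrix; rw [h0, h1]
  unfold crossVec detRow
  rw [hb]

/-! ### Nonvanishing: independent rows -/

/-- The rows of the matrix `(w, Φ y, ∂Φ y)`. [folklore] -/
theorem row_updateRow_baseMatrix (w : 𝔼 (n + 1 + 1)) :
    (updateRow (baseMatrix Φ y) 0 (⇑w)).row =
      Fin.cons (⇑w) (Fin.cons (⇑(Φ y)) fun k : Fin n ↦ ⇑(fderiv ℝ Φ y (EuclideanSpace.single k 1))) := by
  ext i j
  refine Fin.cases ?_ (fun i' ↦ Fin.cases ?_ (fun k ↦ ?_) i') i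
  · simp [Matrix.row, updateRow_self]
  · simp only [Matrix.row, updateRow_ne (Fin.succ_ne_zero _), baseMatrix_one, Fin.cons_succ,
      Fin.cons_zero]
  · simp only [Matrix.row, updateRow_ne (Fin.succ_ne_zero _), baseMatrix_succ_succ, Fin.cons_succ]

/-- **If `(Φ y, ∂₁Φ y, …, ∂ₙΦ y)` are linearly independent, the cross product is non-zero**
(complete them to a basis by some `w`; then `⟪ν̃ y, w⟫ = det ≠ 0`). [folklore] -/
theorem crossVec_ne_zero
    (hli : LinearIndependent ℝ (Fin.cons (Φ y) fun k : Fin n ↦ fderiv ℝ Φ y (EuclideanSpace.single k 1))) :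
    crossVec Φ y ≠ 0 := by
  set F : Fin (n + 1) → 𝔼 (n + 1 + 1) :=
    Fin.cons (Φ y) fun k : Fin n ↦ fderiv ℝ Φ y (EuclideanSpace.single k 1) with hF
  -- a vector outside the span of the `n + 1` independent vectors
  obtain ⟨w, hw⟩ : ∃ w : 𝔼 (n + 1 + 1), w ∉ Submodule.span ℝ (range F) := by
    by_contra h
    push Not at h
    have htop : Submodule.span ℝ (range F) = ⊤ := Submodule.eq_top_iff'.2 h
    have h1 : finrank ℝ (Submodule.span ℝ (range F)) = n + 1 := by
      rw [finrank_span_eq_card hli, Fintype.card_fin]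
    rw [htop, finrank_top, finrank_euclideanSpace_fin] at h1
    omega
  -- the rows of `(w, Φ y, ∂Φ y)` are independent in `ℝⁿ⁺²` (read through `ofLp`)
  set L : 𝔼 (n + 1 + 1) →ₗ[ℝ] (Fin (n + 1 + 1) → ℝ) :=
    (WithLp.linearEquiv 2 ℝ (Fin (n + 1 + 1) → ℝ)).toLinearMap with hL
  have hLa : ∀ v : 𝔼 (n + 1 + 1), L v = ⇑v := fun v ↦ rfl
  have hLker : LinearMap.ker L = ⊥ := LinearMap.ker_eq_bot.2 (WithLp.linearEquiv 2 ℝ _).injective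
  have hliL : LinearIndependent ℝ (L ∘ F) := hli.map' L hLker
  have hwL : L w ∉ Submodule.span ℝ (range (L ∘ F)) := by
    rw [range_comp, ← Submodule.map_span]
    rintro ⟨w', hw', hww'⟩
    have : w' = w := (WithLp.linearEquiv 2 ℝ (Fin (n + 1 + 1) → ℝ)).injective hww'
    exact hw (this ▸ hw')
  have hrows : LinearIndependent ℝ (updateRow (baseMatrix Φ y) 0 (⇑w)).row := by
    rw [row_updateRow_baseMatrix]
    have hLF : (L ∘ F) = Fin.cons (⇑(Φ y)) fun k : Fin n ↦ ⇑(fderiv ℝ Φ y (EuclideanSpace.single k 1)) := by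
      rw [hF, Fin.comp_cons]; rfl
    rw [← hLa w, ← hLF]
    exact linearIndependent_finCons.2 ⟨hliL, hwL⟩
  have hdet : detRow Φ y (⇑w) ≠ 0 := by
    have hU : IsUnit (updateRow (baseMatrix Φ y) 0 (⇑w)) := linearIndependent_rows_iff_isUnit.1 hrows
    exact ((isUnit_iff_isUnit_det _).1 hU).ne_zero
  intro h0
  apply hdet
  rw [← inner_crossVec, h0, inner_zero_left]

/-! ### Immersions into the sphere have independent `(Φ, ∂Φ)` -/

variable {y}

/-- For a smooth immersion `φ : ℝⁿ → Sⁿ⁺¹`, the ambient derivative of `Φ = ι ∘ φ` at `y` is the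
composite of the (injective) differentials of `φ` and of the inclusion `ι : Sⁿ⁺¹ ⊆ ℝⁿ⁺²`.
[folklore] -/
theorem fderiv_coe_comp_eq {φ : 𝔼 n → 𝕊 (n + 1)} (hφ : ContMDiff 𝓘(ℝ, 𝔼 n) (𝓡 (n + 1)) ∞ φ)
    (y : 𝔼 n) :
    fderiv ℝ (fun y ↦ (φ y : 𝔼 (n + 1 + 1))) y =
      (mfderiv (𝓡 (n + 1)) 𝓘(ℝ, 𝔼 (n + 1 + 1)) (Subtype.val : 𝕊 (n + 1) → 𝔼 (n + 1 + 1)) (φ y)).comp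
        (mfderiv 𝓘(ℝ, 𝔼 n) (𝓡 (n + 1)) φ y) := by
  rw [← mfderiv_eq_fderiv]
  exact mfderiv_comp y ((contMDiff_coe_sphere (m := ∞)).contMDiffAt.mdifferentiableAt (by simp))
    ((hφ y).mdifferentiableAt (by simp))

/-- **Along a smooth immersion into the sphere, `(Φ y, ∂₁Φ y, …, ∂ₙΦ y)` are linearly
independent**: the `∂ₖΦ y` are independent (injective differential) and tangent to the sphere,
i.e. orthogonal to the unit vector `Φ y`. [folklore] -/
theorem linearIndependent_cons_fderiv {φ : 𝔼 n → 𝕊 (n + 1)}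
    (hφ : ContMDiff 𝓘(ℝ, 𝔼 n) (𝓡 (n + 1)) ∞ φ)
    (hφimm : Injective (mfderiv 𝓘(ℝ, 𝔼 n) (𝓡 (n + 1)) φ y)) :
    LinearIndependent ℝ (Fin.cons ((φ y : 𝔼 (n + 1 + 1)))
      fun k : Fin n ↦ fderiv ℝ (fun y ↦ (φ y : 𝔼 (n + 1 + 1))) y (EuclideanSpace.single k 1)) := by
  set Φ : 𝔼 n → 𝔼 (n + 1 + 1) := fun y ↦ (φ y : 𝔼 (n + 1 + 1)) with hΦ
  have hd := fderiv_coe_comp_eq hφ y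
  -- the ambient derivative is injective with range in `(Φ y)ᗮ`
  have hinj : Injective (fderiv ℝ Φ y) := by
    rw [hΦ, hd]
    have key : Injective (⇑(mfderiv (𝓡 (n + 1)) 𝓘(ℝ, 𝔼 (n + 1 + 1))
        (Subtype.val : 𝕊 (n + 1) → 𝔼 (n + 1 + 1)) (φ y)) ∘ ⇑(mfderiv 𝓘(ℝ, 𝔼 n) (𝓡 (n + 1)) φ y)) :=
      (mfderiv_coe_sphere_injective (φ y)).comp hφimm
    exact key
  have hperp : ∀ ξ : 𝔼 n, fderiv ℝ Φ y ξ ∈ (ℝ ∙ ((φ y : 𝔼 (n + 1 + 1))))ᗮ := by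
    intro ξ
    rw [hΦ, hd, ← range_mfderiv_coe_sphere (n := n + 1) (φ y)]
    exact ⟨_, rfl⟩
  refine linearIndependent_finCons.2 ⟨?_, ?_⟩
  · have hb := (EuclideanSpace.basisFun (Fin n) ℝ).toBasis.linearIndependent.map'
      (fderiv ℝ Φ y : 𝔼 n →ₗ[ℝ] 𝔼 (n + 1 + 1)) (LinearMap.ker_eq_bot.2 hinj)
    have hfun : (fun k : Fin n ↦ fderiv ℝ Φ y (EuclideanSpace.single k 1)) =
        ⇑(fderiv ℝ Φ y : 𝔼 n →ₗ[ℝ] 𝔼 (n + 1 + 1)) ∘ ⇑(EuclideanSpace.basisFun (Fin n) ℝ).toBasis := by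
      funext k
      simp [EuclideanSpace.basisFun_apply]
    have hgoal : LinearIndependent ℝ (fun k : Fin n ↦ fderiv ℝ Φ y (EuclideanSpace.single k 1)) := by
      rw [hfun]; exact hb
    exact hgoal
  · intro hmem
    have hle : Submodule.span ℝ (range fun k : Fin n ↦ fderiv ℝ Φ y (EuclideanSpace.single k 1)) ≤
        (ℝ ∙ ((φ y : 𝔼 (n + 1 + 1))))ᗮ := by
      rw [Submodule.span_le]
      rintro _ ⟨k, rfl⟩
      exact hperp _
    have h0 : ⟪(φ y : 𝔼 (n + 1 + 1)), (φ y : 𝔼 (n + 1 + 1))⟫ = 0 :=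
      (Submodule.mem_orthogonal_singleton_iff_inner_right).1 (hle hmem)
    rw [real_inner_self_eq_norm_sq, norm_eq_of_mem_sphere (φ y)] at h0
    norm_num at h0


/-! ### Maps into the equatorial hyperplane: the cross product is a multiple of `e₁` -/

/-- For a map `Ψ` with values in the hyperplane `{v₁ = 0}`, the derivative also has values there.
[folklore] -/
theorem fderiv_apply_one_eq_zero {Ψ : 𝔼 n → 𝔼 (n + 1 + 1)} (hΨd : DifferentiableAt ℝ Ψ y)
    (hΨE : ∀ y, Ψ y 1 = 0) (v : 𝔼 n) : fderiv ℝ Ψ y v 1 = 0 := by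
  have hcomp : (fun y ↦ Ψ y 1) =
      ⇑(EuclideanSpace.proj (1 : Fin (n + 1 + 1)) : 𝔼 (n + 1 + 1) →L[ℝ] ℝ) ∘ Ψ := rfl
  have h1 : fderiv ℝ (fun y ↦ Ψ y 1) y =
      (EuclideanSpace.proj (1 : Fin (n + 1 + 1)) : 𝔼 (n + 1 + 1) →L[ℝ] ℝ).comp (fderiv ℝ Ψ y) := by
    rw [hcomp]
    exact ((EuclideanSpace.proj (1 : Fin (n + 1 + 1)) :
      𝔼 (n + 1 + 1) →L[ℝ] ℝ).hasFDerivAt.comp y hΨd.hasFDerivAt).fderiv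
  have h0 : fderiv ℝ (fun y ↦ Ψ y 1) y = 0 := by
    rw [show (fun y ↦ Ψ y 1) = fun _ ↦ (0 : ℝ) from funext hΨE]
    simp
  have := congrArg (fun L : 𝔼 n →L[ℝ] ℝ ↦ L v) (h0.symm.trans h1)
  simpa using this.symm

/-- **For a map into the hyperplane `{v₁ = 0}` the cross product is a multiple of `e₁`**: all its
other coordinates are determinants with a vanishing column. [folklore] -/
theorem crossVec_eq_smul_single {Ψ : 𝔼 n → 𝔼 (n + 1 + 1)} (hΨd : DifferentiableAt ℝ Ψ y)
    (hΨE : ∀ y, Ψ y 1 = 0) :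
    crossVec Ψ y = (crossVec Ψ y 1) • EuclideanSpace.single (1 : Fin (n + 1 + 1)) (1 : ℝ) := by
  ext j
  by_cases hj : j = 1
  · subst hj; simp
  · have hs : (EuclideanSpace.single (1 : Fin (n + 1 + 1)) (1 : ℝ)) j = 0 := by simp [hj]
    rw [PiLp.smul_apply, hs, smul_zero]
    show detRow Ψ y (Pi.single j 1) = 0
    refine det_eq_zero_of_column_eq_zero 1 fun i ↦ ?_
    refine Fin.cases ?_ (fun i' ↦ Fin.cases ?_ (fun k ↦ ?_) i') i
    · rw [updateRow_self, Pi.single_eq_of_ne (Ne.symm hj)]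
    · rw [updateRow_ne (Fin.succ_ne_zero _), baseMatrix_one]; exact hΨE y
    · rw [updateRow_ne (Fin.succ_ne_zero _), baseMatrix_succ_succ]
      exact fderiv_apply_one_eq_zero hΨd hΨE _

/-- A continuous nowhere vanishing real function on `ℝⁿ` has constant sign. [folklore] -/
theorem forall_pos_or_forall_neg {g : 𝔼 n → ℝ} (hg : Continuous g) (h0 : ∀ y, g y ≠ 0) :
    (∀ y, 0 < g y) ∨ (∀ y, g y < 0) := by
  by_contra h
  push Not at h
  obtain ⟨⟨a, ha⟩, ⟨b, hb⟩⟩ := h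
  have hmem : (0 : ℝ) ∈ Icc (g a) (g b) := ⟨ha, hb⟩
  obtain ⟨c, -, hc⟩ := isPreconnected_univ.intermediate_value (mem_univ a) (mem_univ b)
    hg.continuousOn hmem
  exact h0 c hc

/-! ### Main theorem of the file -/

/-- **A unit normal field along an immersed disc in `Sⁿ⁺¹` which is standard where the disc is.**
Let `φ : ℝⁿ → Sⁿ⁺¹` be a smooth immersion which agrees on an open set `U` with a smooth immersion
`ψ` taking values in the equatorial great sphere `{v₁ = 0}`.  Then there is a smooth unit
vector field `ν : ℝⁿ → ℝⁿ⁺²` along `φ`, orthogonal to `φ y` (tangent to the sphere) and to the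
image of the differential of `ι ∘ φ` (normal to the disc), which equals the constant vector `e₁`
on `U`.  Construction: the normalised generalised cross product `⋆(Φ ∧ ∂₁Φ ∧ ⋯ ∧ ∂ₙΦ)`,
`Φ = ι ∘ φ` — a determinant, hence smooth; non-zero because `(Φ, ∂Φ)` are independent; along
`ψ` it is `±e₁` with a sign that is constant on the connected `ℝⁿ`, corrected globally.  (The
triviality of the normal bundle of a hypersurface disc, in the explicit form needed to thicken
the `n`-ball `Δ₁` of Budney–Gabai's Cerf–Palais remark to an `(n+1)`-disc.) [folklore] -/
theorem exists_unitNormal {φ ψ : 𝔼 n → 𝕊 (n + 1)}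
    (hφ : ContMDiff 𝓘(ℝ, 𝔼 n) (𝓡 (n + 1)) ∞ φ)
    (hφimm : ∀ y, Injective (mfderiv 𝓘(ℝ, 𝔼 n) (𝓡 (n + 1)) φ y))
    (hψ : ContMDiff 𝓘(ℝ, 𝔼 n) (𝓡 (n + 1)) ∞ ψ)
    (hψimm : ∀ y, Injective (mfderiv 𝓘(ℝ, 𝔼 n) (𝓡 (n + 1)) ψ y))
    (hψE : ∀ y, (ψ y : 𝔼 (n + 1 + 1)) 1 = 0) {U : Set (𝔼 n)} (hU : IsOpen U)
    (hφψ : ∀ y ∈ U, φ y = ψ y) :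
    ∃ ν : 𝔼 n → 𝔼 (n + 1 + 1), ContDiff ℝ ∞ ν ∧ (∀ y, ‖ν y‖ = 1) ∧
      (∀ y, ⟪ν y, (φ y : 𝔼 (n + 1 + 1))⟫ = 0) ∧
      (∀ y ξ, ⟪ν y, fderiv ℝ (fun y ↦ (φ y : 𝔼 (n + 1 + 1))) y ξ⟫ = 0) ∧
      (∀ y ∈ U, ν y = EuclideanSpace.single (1 : Fin (n + 1 + 1)) (1 : ℝ)) := by
  set Φ : 𝔼 n → 𝔼 (n + 1 + 1) := fun y ↦ (φ y : 𝔼 (n + 1 + 1)) with hΦdef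
  set Ψ : 𝔼 n → 𝔼 (n + 1 + 1) := fun y ↦ (ψ y : 𝔼 (n + 1 + 1)) with hΨdef
  have hΦs : ContDiff ℝ ∞ Φ := contMDiff_iff_contDiff.1 ((contMDiff_coe_sphere (m := ∞)).comp hφ)
  have hΨs : ContDiff ℝ ∞ Ψ := contMDiff_iff_contDiff.1 ((contMDiff_coe_sphere (m := ∞)).comp hψ)
  have hneΦ : ∀ y, crossVec Φ y ≠ 0 := fun y ↦
    crossVec_ne_zero y (linearIndependent_cons_fderiv hφ (hφimm y))
  have hneΨ : ∀ y, crossVec Ψ y ≠ 0 := fun y ↦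
    crossVec_ne_zero y (linearIndependent_cons_fderiv hψ (hψimm y))
  -- along `ψ` the cross product is `c y • e₁` with `c` of constant sign
  set c : 𝔼 n → ℝ := fun y ↦ crossVec Ψ y 1 with hcdef
  have hcΨ : ∀ y, crossVec Ψ y = c y • EuclideanSpace.single (1 : Fin (n + 1 + 1)) (1 : ℝ) :=
    fun y ↦ crossVec_eq_smul_single ((hΨs.differentiable (by simp)) y) hψE
  have hc0 : ∀ y, c y ≠ 0 := fun y h ↦ hneΨ y (by rw [hcΨ y, h, zero_smul])
  have hcc : Continuous c :=
    ((contDiff_euclidean.1 (contDiff_crossVec hΨs)) 1).continuous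
  obtain ⟨σ, hσ1, hσc⟩ : ∃ σ : ℝ, |σ| = 1 ∧ ∀ y, 0 < σ * c y := by
    rcases forall_pos_or_forall_neg hcc hc0 with h | h
    · exact ⟨1, by simp, fun y ↦ by simpa using h y⟩
    · exact ⟨-1, by simp, fun y ↦ by simpa using h y⟩
  -- the normal field
  refine ⟨fun y ↦ σ • ((‖crossVec Φ y‖)⁻¹ • crossVec Φ y), ?_, ?_, ?_, ?_, ?_⟩
  · have hinv : ContDiff ℝ ∞ (fun y ↦ (‖crossVec Φ y‖)⁻¹) := by
      rw [contDiff_iff_contDiffAt]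
      intro y
      exact ((contDiffAt_norm ℝ (hneΦ y)).comp y (contDiff_crossVec hΦs).contDiffAt).inv
        (norm_ne_zero_iff.2 (hneΦ y))
    exact (contDiff_const (c := σ)).smul (hinv.smul (contDiff_crossVec hΦs))
  · intro y
    rw [norm_smul, norm_smul, norm_inv, norm_norm, inv_mul_cancel₀ (norm_ne_zero_iff.2 (hneΦ y)),
      Real.norm_eq_abs, hσ1, one_mul]
  · intro y
    rw [real_inner_smul_left, real_inner_smul_left, inner_crossVec_self, mul_zero, mul_zero]
  · intro y ξ
    rw [real_inner_smul_left, real_inner_smul_left, inner_crossVec_fderiv, mul_zero, mul_zero]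
  · intro y hy
    -- locality: `Φ = Ψ` near `y`
    have hev : Φ =ᶠ[𝓝 y] Ψ := by
      filter_upwards [hU.mem_nhds hy] with y' hy'
      exact congrArg Subtype.val (hφψ y' hy')
    have hcong : crossVec Φ y = crossVec Ψ y :=
      crossVec_congr y (congrArg Subtype.val (hφψ y hy)) hev.fderiv_eq
    have hnorm : ‖crossVec Ψ y‖ = |c y| := by
      rw [hcΨ y, norm_smul, Real.norm_eq_abs]
      simp
    show σ • ((‖crossVec Φ y‖)⁻¹ • crossVec Φ y) = EuclideanSpace.single 1 1
    rw [hcong, hnorm, hcΨ y, smul_smul, smul_smul]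
    have h1 : |c y| = σ * c y := by
      have h2 : |σ * c y| = σ * c y := abs_of_pos (hσc y)
      rw [abs_mul, hσ1, one_mul] at h2
      exact h2
    have hne : σ * c y ≠ 0 := (hσc y).ne'
    have key : σ * |c y|⁻¹ * c y = 1 := by
      rw [h1]
      have h3 : σ * (σ * c y)⁻¹ * c y = (σ * c y) * (σ * c y)⁻¹ := by ring
      rw [h3, mul_inv_cancel₀ hne]
    rw [key, one_smul]

end Surgery

end BudneyGabai2019_thm_3_13

end Literature.Topology.FourManifolds

end
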